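import Summits.QuantumFields.YangMills.Theses.ConvexGribovBody
import Summits.QuantumFields.YangMills.Theses.FradkinShenkerFlow
import Summits.QuantumFields.YangMills.Theorems.FradkinShenkerFlowPoincareToClusteringDefs
import Summits.QuantumFields.YangMills.Theorems.ConvexGribovBodyBrascampLiebVacuumSCStubSliceRestriction
import Summits.QuantumFields.YangMills.Theorems.ConvexGribovBodyBrascampLiebVacuumSCStubFloorReduction
import Summits.QuantumFields.YangMills.Theorems.ConvexGribovBodyBrascampLiebVacuumSCStubOnelinkHS
import Summits.QuantumFields.YangMills.Theorems.ConvexGribovBodyBrascampLiebVacuumSCFloor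

/-!
# Crux `BrascampLiebVacuumSC` (stmt-QuantumFields-16404) from the uniform heat-bath Poincaré inequality
# (route `ConvexGribovBody` of `YangMills`, line `SketchIdeator1`; lead c4, 2026-08-17)

The line `SketchIdeator1` (`Cruxes/BrascampLiebVacuumSC/Lines/SketchIdeator1.lean`, skeleton v9) closes the
crux `Summit.QuantumFields.YangMills.Theses.ConvexGribovBody.BrascampLiebVacuumSC` — for simply-connected
compact simple `G` and faithful `r`, per `β ≥ β₀`, a volume-uniform Poincaré inequality
`Var_μ f ≤ C(β) · Dmax(β,S) · dir f` for gauge-invariant link-Lipschitz functions `f` of the time-zero spatial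
links — modulo ONE physics input, the uniform (in the volume) one-link heat-bath Poincaré inequality
UP(β ≥ β₀) for simply-connected `G`. Everything else is LANDED:

* slice restriction + one-link Holley–Stroock (`stub_sliceRestriction` p124378, `stub_onelinkHS` p126464):
  UP ⇒ `Var f ≤ 2 C κ₁ · dir f` for admissible slice `f`;
* Parseval (`stub_floorReduction` p124550): `∫ sup_h L⁻³ Σ‖A^h‖² ≤ Dmax`;
* the FLOOR (`Theorems/ConvexGribovBodyBrascampLiebVacuumSCFloor.lean`, `floorCore`, lead c4): for every `β`
  a `d(β) > 0` below `∫ sup_h L⁻³ Σ‖A^h‖²` on all large tori, for EVERY simply-connected compact simple `G`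
  (cube orbit functional + block freeing + the cube witness from the Haar dimension gap, the latter from
  metric entropy and classification-free Lie theory — 25 stubs of leads 0–c4).

This file records the composition in two forms: `BrascampLiebVacuumSC_of_up` (hypothesis = UP_SC verbatim,
the registered `stub_up`) and `BrascampLiebVacuumSC_of_susceptibility`, CONDITIONAL on the two existing items
of route FradkinShenkerFlow whose conjunction gives UP_SC: `FiniteSusceptibilityWeakCoupling`
(stmt-QuantumFields-9442, Chatterjee's Problem 5.1 at weak coupling — the open problem) and
`SusceptibilityToPoincare` (stmt-QuantumFields-9441). The item stays open until UP_SC is proved.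
-/

open scoped BigOperators Topology Matrix
open Filter MeasureTheory ProbabilityTheory
open Literature.MathematicalPhysics.QuantumFieldTheory
open Summit.QuantumFields.YangMills.Cruxes.CovarianceBound.SupportWindow
  (froSq coulombF IsCoulMin gluon wilson4)
open Summit.QuantumFields.YangMills.Theorems.PoincareClustering (hbLaw hbOp)

noncomputable section

namespace Summit.QuantumFields.YangMills.Theorems.BrascampLiebVacuumSC

/-- **The crux from UP_SC.** If for every simply-connected compact simple `G` and faithful `r` the torus
Wilson measures satisfy the one-link heat-bath Poincaré inequality `Var F ≤ C(β) Σ_ℓ E[Var_{ν_ℓ}F]` for all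
bounded measurable `F`, with one constant on all tori `S ≥ S₀(β)`, at every `β ≥ β₀(G, r)` (the line's
`stub_up`), then `BrascampLiebVacuumSC` holds: `β₀ := β₀(UP)`, `C(β) := (2 C_UP(β) κ₁(β) + 1)/d(β)` with
`κ₁` the one-link Holley–Stroock constant and `d(β)` the floor, `S₀ := max`; then
`Var f ≤ 2Cκ₁ · dir f ≤ C(β) · d · dir f ≤ C(β) · Dmax · dir f`. [folklore] -/
theorem BrascampLiebVacuumSC_of_up
    (hUP : ∀ (G : Type) [Group G] [TopologicalSpace G] [IsTopologicalGroup G] [CompactSpace G]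
      [MeasurableSpace G] [BorelSpace G], IsCompactSimpleLieGroup G → SimplyConnectedSpace G →
      ∀ r : LatticeRep G, ∃ β₀ : ℝ, ∀ β : ℝ, β₀ ≤ β → ∃ C : ℝ, 0 ≤ C ∧ ∃ S₀ : ℕ, ∀ S : ℕ, S₀ ≤ S →
      ∀ F : GaugeConfig 4 (2 * S + 1) G → ℝ, Measurable F → (∃ M : ℝ, ∀ U, |F U| ≤ M) →
        variance F (wilson4 r β S) ≤
          C * ∑ ℓ : Edge 4 (2 * S + 1), ∫ U, ∫ g, (F U - F (Function.update U ℓ g)) ^ 2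
            ∂(hbLaw r.ρ β ℓ U) ∂(wilson4 r β S)) :
    Summit.QuantumFields.YangMills.Theses.ConvexGribovBody.BrascampLiebVacuumSC := by
  intro G _ _ _ _ _ _ hG hSC r
  obtain ⟨β₁, h₁⟩ := hUP G hG hSC r
  refine ⟨β₁, fun β hβ => ?_⟩
  obtain ⟨C, hC0, S₁, hUP'⟩ := h₁ β hβ
  obtain ⟨κ₁, hκ0, hHS⟩ := stub_onelinkHS G hG r β
  obtain ⟨d, hd, S₃, hfl⟩ := floorCore G hG hSC r β
  refine ⟨(2 * C * κ₁ + 1) / d, by positivity, max S₁ S₃, fun S hS => ?_⟩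
  intro μ fro coul cov Dmax slope dir f hf₁ hf₂ hf₃
  have hA : ∫ U, (f U - ∫ V, f V ∂μ) ^ 2 ∂μ ≤ 2 * C * κ₁ * dir f :=
    stub_sliceRestriction G r β C κ₁ S hC0 hκ0 (hUP' S (le_trans (le_max_left _ _) hS)) (hHS S)
      f hf₁ hf₂ hf₃
  have hred : ∫ U, (⨆ h : {h : Site 4 (2 * S + 1) → G // IsCoulMin r S U h},
      (∑ j : Fin 3, ∑ y : Fin 3 → ZMod (2 * S + 1), froSq (gluon r S U h.1 y j)) /
        ((2 * S + 1 : ℝ) ^ 3)) ∂(wilson4 r β S) ≤ Dmax :=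
    stub_floorReduction G r β S
  have hDmax : d ≤ Dmax := (hfl S (le_trans (le_max_right _ _) hS)).trans hred
  have hdir : 0 ≤ dir f := by
    refine Finset.sum_nonneg fun e _ => ?_
    split_ifs
    · exact integral_nonneg fun U => sq_nonneg _
    · exact le_rfl
  refine hA.trans ?_
  have h1 : 2 * C * κ₁ ≤ (2 * C * κ₁ + 1) / d * Dmax := by
    rw [div_mul_eq_mul_div, le_div_iff₀ hd]
    nlinarith [mul_le_mul_of_nonneg_left hDmax (by positivity : (0 : ℝ) ≤ 2 * C * κ₁ + 1)]
  exact mul_le_mul_of_nonneg_right h1 hdir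

/-- **The crux conditional on route FradkinShenkerFlow's items stmt-9442 ∧ stmt-9441.**
`FiniteSusceptibilityWeakCoupling` (finite susceptibility of all gauge-invariant local observables at weak
coupling, the open problem) and `SusceptibilityToPoincare` (finite susceptibility ⇒ uniform heat-bath
Poincaré) give UP_SC (with `C ↦ max C 0`, `S₀ := 0`; simple connectivity unused there), hence the crux by
`BrascampLiebVacuumSC_of_up`. CONDITIONAL result: the item stmt-QuantumFields-16404 closes only when UP_SC
is proved. [folklore] -/
theorem BrascampLiebVacuumSC_of_susceptibility
    (hFS : Summit.QuantumFields.YangMills.Theses.FradkinShenkerFlow.FiniteSusceptibilityWeakCoupling)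
    (hSP : Summit.QuantumFields.YangMills.Theses.FradkinShenkerFlow.SusceptibilityToPoincare) :
    Summit.QuantumFields.YangMills.Theses.ConvexGribovBody.BrascampLiebVacuumSC := by
  refine BrascampLiebVacuumSC_of_up ?_
  intro G _ _ _ _ _ _ hG _ r
  obtain ⟨β₀, hβ₀⟩ := hFS G hG r
  refine ⟨max β₀ 0, fun β hβ => ?_⟩
  have h0 : (0 : ℝ) ≤ β := le_trans (le_max_right _ _) hβ
  obtain ⟨C, hC⟩ := hSP G hG r β h0 (hβ₀ β (le_trans (le_max_left _ _) hβ))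
  refine ⟨max C 0, le_max_right _ _, 0, fun S _ F hF hM => ?_⟩
  refine (hC S F hF hM).trans ?_
  refine mul_le_mul_of_nonneg_right (le_max_left _ _) ?_
  refine Finset.sum_nonneg fun ℓ _ => integral_nonneg fun U => integral_nonneg fun g => sq_nonneg _

end Summit.QuantumFields.YangMills.Theorems.BrascampLiebVacuumSC

end
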